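import Summits.KontsevichZagierPeriods.KontsevichZagierPeriods.Theorems.RealOnePeriodRelations.Negative.Kit
import Summits.KontsevichZagierPeriods.KontsevichZagierPeriods.Theorems.HermiteRigidityGenusTwoCycleTransferPushforwardDimOne
import Literature.NumberTheory.Transcendental.KZSemialgebraicComplex
import Literature.NumberTheory.Transcendental.SemialgebraicLineDeriv
import Literature.NumberTheory.Transcendental.SemialgebraicMapsProofs
import Literature.NumberTheory.Transcendental.SemialgebraicDerivativeProofs
import Mathlib.MeasureTheory.Function.Jacobian

/-!
# `RealOnePeriodRelations` (stmt-KontsevichZagierPeriods-10042), line `nash-retraction-thin-strip` —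
# stub `stub_normalisation`: cells, part 2 (pull-back of a cell along a semialgebraic `C¹` chart; rays)

Rule 2 in dimension one, in the direction the cell decomposition needs it (design note
`Cruxes/RealOnePeriodRelations/Lines/nash-retraction-thin-strip.normalisation-r0.md`, step N2): a representation
`[∫_{φ(0,1)} f]` over the image of the unit interval under an injective `ℚ`-semialgebraic map `φ` with a
derivative `φ′` on `(0,1)` is equivalent to `[∫₀¹ |φ′(s)| f(φ(s)) ds]` by ONE instance of rule 2
(`helper_normalisation_r0_3`, registered helper anchor; the derivative is `ℚ`-semialgebraic by
`IsSemialgebraicFunOn.hasDerivAt_isSemialgebraic_holds`, integrability is transported by Mathlib's Jacobian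
formula). The two RAY charts `s ↦ p − 1 + 1/s : (0,1) → (p, ∞)` and `s ↦ q + 1 − 1/s : (0,1) → (−∞, q)` with
algebraic `p`, `q` are recorded as instances (`ray_right_image`, `ray_left_image`, semialgebraicity, derivative).

References: M. Kontsevich, D. Zagier, *Periods* (2001), §1.2 rule (2).
-/

noncomputable section

open scoped BigOperators
open Set MeasureTheory
open Literature.NumberTheory.Transcendental
open Literature.ModelTheory.ExponentialFields (IsSemialgebraic)
open Summit.KontsevichZagierPeriods.SymplecticScissors.RealOnePeriodRelationsNegative
  (M₁ unitDom isSemialgebraic_unitDom measurableSet_unitDom)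

namespace Summit.KontsevichZagierPeriods.SymplecticScissors.RealOnePeriodRelations

/-- **Pull-back of a cell along a semialgebraic `C¹` chart** (registered helper anchor
`helper_normalisation_r0_3` of `stub_normalisation`). If `φ : ℝ → ℝ` is `ℚ`-semialgebraic on `(0,1)`,
injective there, with derivative `φ′ t` at every `t ∈ (0,1)`, and `r.domain = φ((0,1))` (as a subset of `ℝ¹`),
then there is a representation `r′` over `(0,1)` with integrand `|φ′(s)| · f(φ(s))` and `[r′] − [r]` is ONE
instance of rule 2 (map `z ↦ (φ (z 0))`, derivative `φ′(z 0) • id`, `|det| = |φ′(z 0)|`).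
[cite: KontsevichZagier2001, §1.2 rule (2)] -/
theorem helper_normalisation_r0_3 : ∀ (r : KZ.IntegralRep 1) (φ φ' : ℝ → ℝ),
    IsSemialgebraicFunOn ℚ {z : Fin 1 → ℝ | z 0 ∈ Set.Ioo (0 : ℝ) 1} (fun z => φ (z 0)) →
    (∀ t ∈ Set.Ioo (0 : ℝ) 1, HasDerivAt φ (φ' t) t) → InjOn φ (Set.Ioo (0 : ℝ) 1) →
    r.domain = (fun z : Fin 1 → ℝ => fun _ : Fin 1 => φ (z 0)) '' {z : Fin 1 → ℝ | z 0 ∈ Set.Ioo (0 : ℝ) 1} →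
    ∃ r' : KZ.IntegralRep 1, r'.domain = {z | z 0 ∈ Set.Ioo (0 : ℝ) 1} ∧
      (∀ z ∈ r'.domain, r'.integrand z = |φ' (z 0)| * r.integrand (fun _ : Fin 1 => φ (z 0))) ∧
      KZ.of r' - KZ.of r ∈ KZ.changeOfVariablesRel := by
  intro r φ φ' hsa hder hinjφ hdom
  obtain ⟨Φ, hΦ⟩ : ∃ Φ : (Fin 1 → ℝ) → (Fin 1 → ℝ), Φ = fun z => fun _ => φ (z 0) := ⟨_, rfl⟩
  obtain ⟨Φ', hΦ'⟩ : ∃ Φ' : (Fin 1 → ℝ) → (Fin 1 → ℝ) →L[ℝ] (Fin 1 → ℝ),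
      Φ' = fun z => (φ' (z 0)) • ContinuousLinearMap.id ℝ (Fin 1 → ℝ) := ⟨_, rfl⟩
  have hΦapply : ∀ z : Fin 1 → ℝ, Φ z = fun _ => φ (z 0) := fun z => by rw [hΦ]
  have hderiv : ∀ z ∈ {z : Fin 1 → ℝ | z 0 ∈ Set.Ioo (0 : ℝ) 1}, HasFDerivAt Φ (Φ' z) z := fun z hz => by
    rw [hΦ, hΦ']
    exact Summit.KontsevichZagierPeriods.HermiteRigidity.GenusTwoCycleTransfer.hasFDerivAt_fin_one
      φ (φ' (z 0)) z (hder (z 0) hz)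
  have hdet : ∀ z : Fin 1 → ℝ, |(Φ' z).det| = |φ' (z 0)| := fun z => by
    rw [hΦ']
    show |((φ' (z 0)) • ContinuousLinearMap.id ℝ (Fin 1 → ℝ)).det| = |φ' (z 0)|
    rw [Summit.KontsevichZagierPeriods.HermiteRigidity.GenusTwoCycleTransfer.det_smul_id_fin_one]
  have hinj : InjOn Φ {z : Fin 1 → ℝ | z 0 ∈ Set.Ioo (0 : ℝ) 1} := by
    intro z hz w hw hzw
    rw [hΦapply, hΦapply] at hzw
    have h0 : φ (z 0) = φ (w 0) := congr_fun hzw 0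
    have h1 : z 0 = w 0 := hinjφ hz hw h0
    funext i
    rw [Subsingleton.elim i 0, h1]
  have himg : Φ '' {z : Fin 1 → ℝ | z 0 ∈ Set.Ioo (0 : ℝ) 1} = r.domain := by rw [hdom, hΦ]
  have hmaps : MapsTo Φ {z : Fin 1 → ℝ | z 0 ∈ Set.Ioo (0 : ℝ) 1} r.domain := by
    rw [← himg]
    exact mapsTo_image Φ _
  have hsaΦ : IsSemialgebraicMapOn ℚ {z : Fin 1 → ℝ | z 0 ∈ Set.Ioo (0 : ℝ) 1} Φ := by
    rw [hΦ]
    exact IsSemialgebraicMapOn.of_forall isSemialgebraic_unitDom fun _ => hsa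
  -- the derivative is semialgebraic on `(0,1)`
  have hsa' : IsSemialgebraicFunOn ℚ {z : Fin 1 → ℝ | z 0 ∈ Set.Ioo (0 : ℝ) 1} (fun z => |φ' (z 0)|) :=
    (IsSemialgebraicFunOn.hasDerivAt_isSemialgebraic_holds 0 1 φ φ' zero_lt_one hsa hder).abs
  have hsaI : IsSemialgebraicFunOn ℚ {z : Fin 1 → ℝ | z 0 ∈ Set.Ioo (0 : ℝ) 1}
      (fun z => |φ' (z 0)| * r.integrand (Φ z)) :=
    hsa'.fun_mul (IsSemialgebraicFunOn.comp_isSemialgebraicMapOn_holds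
      r.isSemialgebraicFunOn_integrand hsaΦ hmaps)
  have hint : IntegrableOn (fun z => |φ' (z 0)| * r.integrand (Φ z)) {z : Fin 1 → ℝ | z 0 ∈ Set.Ioo (0 : ℝ) 1} := by
    have h := (integrableOn_image_iff_integrableOn_abs_det_fderiv_smul (μ := volume) measurableSet_unitDom
      (fun z hz => (hderiv z hz).hasFDerivWithinAt) hinj r.integrand).1
      (by rw [show (unitDom : Set (Fin 1 → ℝ)) = {z : Fin 1 → ℝ | z 0 ∈ Set.Ioo (0 : ℝ) 1} from rfl, himg]
          exact r.integrableOn)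
    refine h.congr_fun (fun z _ => ?_) measurableSet_unitDom
    simp only [hdet, smul_eq_mul]
  let r' : KZ.IntegralRep 1 :=
    ⟨{z : Fin 1 → ℝ | z 0 ∈ Set.Ioo (0 : ℝ) 1}, fun z => |φ' (z 0)| * r.integrand (Φ z), isSemialgebraic_unitDom,
      hsaI, hint⟩
  refine ⟨r', rfl, fun z _ => ?_, ?_⟩
  · show |φ' (z 0)| * r.integrand (Φ z) = |φ' (z 0)| * r.integrand (fun _ : Fin 1 => φ (z 0))
    rw [hΦapply]
  refine ⟨1, r', r, Φ, Φ', hsaΦ, fun z hz => (hderiv z hz).hasFDerivWithinAt, hinj, himg.symm, fun z _ => ?_, rfl⟩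
  show |φ' (z 0)| * r.integrand (Φ z) = r.integrand (Φ z) * |(Φ' z).det|
  rw [hdet, mul_comm]

namespace NormalisationCells

/-- The right ray chart `s ↦ p − 1 + 1/s` maps `(0,1)` onto `(p, ∞)` (in `ℝ¹`). [folklore] -/
theorem ray_right_image (p : ℝ) :
    (fun z : Fin 1 → ℝ => fun _ : Fin 1 => p - 1 + (z 0)⁻¹) '' {z : Fin 1 → ℝ | z 0 ∈ Set.Ioo (0 : ℝ) 1} =
      {z : Fin 1 → ℝ | p < z 0} := by
  ext w
  simp only [mem_image, mem_setOf_eq, mem_Ioo]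
  constructor
  · rintro ⟨z, ⟨hz0, hz1⟩, rfl⟩
    have : 1 < (z 0)⁻¹ := (one_lt_inv₀ hz0).2 hz1
    show p < p - 1 + (z 0)⁻¹
    linarith
  · intro hw
    have hpos : 0 < w 0 - p + 1 := by linarith
    refine ⟨fun _ => (w 0 - p + 1)⁻¹, ⟨inv_pos.2 hpos, ?_⟩, ?_⟩
    · rw [inv_lt_one₀ hpos]
      linarith
    · funext i
      rw [Subsingleton.elim i 0]
      show p - 1 + ((w 0 - p + 1)⁻¹)⁻¹ = w 0
      rw [inv_inv]
      ring

/-- The left ray chart `s ↦ q + 1 − 1/s` maps `(0,1)` onto `(−∞, q)` (in `ℝ¹`). [folklore] -/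
theorem ray_left_image (q : ℝ) :
    (fun z : Fin 1 → ℝ => fun _ : Fin 1 => q + 1 - (z 0)⁻¹) '' {z : Fin 1 → ℝ | z 0 ∈ Set.Ioo (0 : ℝ) 1} =
      {z : Fin 1 → ℝ | z 0 < q} := by
  ext w
  simp only [mem_image, mem_setOf_eq, mem_Ioo]
  constructor
  · rintro ⟨z, ⟨hz0, hz1⟩, rfl⟩
    have : 1 < (z 0)⁻¹ := (one_lt_inv₀ hz0).2 hz1
    show q + 1 - (z 0)⁻¹ < q
    linarith
  · intro hw
    have hpos : 0 < q - w 0 + 1 := by linarith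
    refine ⟨fun _ => (q - w 0 + 1)⁻¹, ⟨inv_pos.2 hpos, ?_⟩, ?_⟩
    · rw [inv_lt_one₀ hpos]
      linarith
    · funext i
      rw [Subsingleton.elim i 0]
      show q + 1 - ((q - w 0 + 1)⁻¹)⁻¹ = w 0
      rw [inv_inv]
      ring

/-- The right ray chart is `ℚ`-semialgebraic on `(0,1)` for algebraic `p`. [folklore] -/
theorem ray_right_isSemialgebraicFunOn {p : ℝ} (hp : IsAlgebraic ℚ p) :
    IsSemialgebraicFunOn ℚ {z : Fin 1 → ℝ | z 0 ∈ Set.Ioo (0 : ℝ) 1} (fun z => p - 1 + (z 0)⁻¹) := by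
  have hc : IsSemialgebraicFunOn ℚ {z : Fin 1 → ℝ | z 0 ∈ Set.Ioo (0 : ℝ) 1} (fun _ => p - 1) :=
    isSemialgebraicFunOn_const_of_isAlgebraic isSemialgebraic_unitDom (hp.sub isAlgebraic_one)
  have hx : IsSemialgebraicFunOn ℚ unitDom (fun z : Fin 1 → ℝ => z 0) := by
    simpa using isSemialgebraicFunOn_aeval isSemialgebraic_unitDom
      (MvPolynomial.X (0 : Fin 1) : MvPolynomial (Fin 1) ℚ)
  exact hc.fun_add hx.fun_inv

/-- The left ray chart is `ℚ`-semialgebraic on `(0,1)` for algebraic `q`. [folklore] -/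
theorem ray_left_isSemialgebraicFunOn {q : ℝ} (hq : IsAlgebraic ℚ q) :
    IsSemialgebraicFunOn ℚ {z : Fin 1 → ℝ | z 0 ∈ Set.Ioo (0 : ℝ) 1} (fun z => q + 1 - (z 0)⁻¹) := by
  have hc : IsSemialgebraicFunOn ℚ {z : Fin 1 → ℝ | z 0 ∈ Set.Ioo (0 : ℝ) 1} (fun _ => q + 1) :=
    isSemialgebraicFunOn_const_of_isAlgebraic isSemialgebraic_unitDom (hq.add isAlgebraic_one)
  have hx : IsSemialgebraicFunOn ℚ unitDom (fun z : Fin 1 → ℝ => z 0) := by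
    simpa using isSemialgebraicFunOn_aeval isSemialgebraic_unitDom
      (MvPolynomial.X (0 : Fin 1) : MvPolynomial (Fin 1) ℚ)
  exact hc.fun_sub hx.fun_inv

/-- Derivative of the right ray chart: `d/ds (p − 1 + 1/s) = −1/s²` on `(0,1)`. [folklore] -/
theorem ray_right_hasDerivAt (p : ℝ) {t : ℝ} (ht : t ∈ Set.Ioo (0 : ℝ) 1) :
    HasDerivAt (fun s => p - 1 + s⁻¹) (-(t ^ 2)⁻¹) t := by
  simpa using (hasDerivAt_inv ht.1.ne').const_add (p - 1)

/-- Derivative of the left ray chart: `d/ds (q + 1 − 1/s) = 1/s²` on `(0,1)`. [folklore] -/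
theorem ray_left_hasDerivAt (q : ℝ) {t : ℝ} (ht : t ∈ Set.Ioo (0 : ℝ) 1) :
    HasDerivAt (fun s => q + 1 - s⁻¹) ((t ^ 2)⁻¹) t := by
  simpa using (hasDerivAt_inv ht.1.ne').const_sub (q + 1)

/-- The right ray chart is injective on `(0,1)`. [folklore] -/
theorem ray_right_injOn (p : ℝ) : InjOn (fun s : ℝ => p - 1 + s⁻¹) (Set.Ioo (0 : ℝ) 1) := by
  intro s _ t _ h
  have : s⁻¹ = t⁻¹ := by simpa using h
  exact inv_injective this

/-- The left ray chart is injective on `(0,1)`. [folklore] -/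
theorem ray_left_injOn (q : ℝ) : InjOn (fun s : ℝ => q + 1 - s⁻¹) (Set.Ioo (0 : ℝ) 1) := by
  intro s _ t _ h
  have : s⁻¹ = t⁻¹ := by simpa using h
  exact inv_injective this

end NormalisationCells

end Summit.KontsevichZagierPeriods.SymplecticScissors.RealOnePeriodRelations

end
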